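import Literature.NumberTheory.CubicFields.CubicFieldDiscriminant14539
import HarnessLib

/-!
# The cubic field of discriminant `−14539` (LMFDB 3.1.14539.1), part 2: the primes above `p ≤ 11` are principal — PROVED

Sequel of `CubicFieldDiscriminant14539.lean` (same seat, same namespace `Literature.NumberTheory.CubicFields.CubicDisc14539`; §1–§2 there: the polynomial,
`d_F = −14539`, `𝓞_F = ℤ[θ]`, signature).  THEOREMS ONLY; every statement PROVED.  §3 (first half, this file): the `θ`-relation and
every prime of `𝓞_F` above `p ≤ 11` is principal (explicit generators / inert primes, Dedekind–Kummer); the primes above `13 ≤ p ≤ 31` and §4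
(★ `h_F = 1` by Minkowski, `not_two_dvd_classNumber`) are in the sequel `CubicFieldDiscriminant14539ClassNumber.lean`.  Written by the prover seat `bsd-line-att-p4` g38 (cell `bsd-f1-sign2`; g27's template) for the curve `[1,1,1,−11,−20]` of conductor
`14539 = 7·31·67` on the doors-dead sub-cell (u1/u7) of crux C2 — the datum «`h(ℚ(β)) = 1`» of att-p3's / att-p5's class-group doors.

References: [LMFDB] number field 3.1.14539.1 (class number 1); [Marcus2018] Ch. 3 Thm. 27, Ch. 5 Thm. 37 and Cor. 2.
-/

noncomputable section

open Polynomial NumberField NumberField.InfinitePlace Ideal Module Real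
open Literature.NumberTheory.NumberFields
open Literature.NumberTheory.NumberFields.MonicCubic

namespace Literature.NumberTheory.CubicFields.CubicDisc14539

section NumberField

variable {F : Type*} [Field F] [NumberField F] {α : F}

/-! ## §3 The primes of norm `≤ 34` are principal -/

/-- The cubic relation `θ³ + aθ² + bθ + c = 0` in `𝓞_F`, numerals pushed (private helper). [folklore] -/
private theorem theta_rel (hα : aeval α (poly (-6) (16) (7)) = 0) :
    thetaInt hα ^ 3 + (-6) * thetaInt hα ^ 2 + (16) * thetaInt hα + (7) = 0 := by
  have h := thetaInt_rel hα
  push_cast at h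
  linear_combination h

/-- `(2, θ + 1) = (-387 + 134 * θ - 21 * θ ^ 2)` (an element of norm `±2`). [cite: Marcus2018, Ch. 3, Thm. 27] -/
theorem span_2_lin1_eq (hα : aeval α (poly (-6) (16) (7)) = 0) :
    span {(2 : 𝓞 F), thetaInt hα + 1} = span {-387 + 134 * thetaInt hα - 21 * thetaInt hα ^ 2} := by
  have hrel := theta_rel hα
  apply le_antisymm
  · rw [span_le]
    rintro x hx
    rcases hx with rfl | hx
    · exact mem_span_singleton'.mpr ⟨-1 - 3 * thetaInt hα - thetaInt hα ^ 2, by linear_combination (55 + 21 * thetaInt hα) * hrel⟩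
    · rw [Set.mem_singleton_iff.mp hx]
      exact mem_span_singleton'.mpr ⟨3 + 6 * thetaInt hα - 5 * thetaInt hα ^ 2, by linear_combination (-166 + 105 * thetaInt hα) * hrel⟩
  · rw [span_singleton_le_iff_mem, mem_span_pair]
    exact ⟨-208 + 33 * thetaInt hα + 10 * thetaInt hα ^ 2, -6 - 6 * thetaInt hα - 5 * thetaInt hα ^ 2, by linear_combination (-5) * hrel⟩

/-- `(2, θ² + 1θ + 1) = (-1 - 3 * θ - θ ^ 2)` (an element of norm `4`). [cite: Marcus2018, Ch. 3, Thm. 27] -/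
theorem span_2_quad_eq (hα : aeval α (poly (-6) (16) (7)) = 0) :
    span {(2 : 𝓞 F), thetaInt hα ^ 2 + thetaInt hα + 1} = span {-1 - 3 * thetaInt hα - thetaInt hα ^ 2} := by
  have hrel := theta_rel hα
  apply le_antisymm
  · rw [span_le]
    rintro x hx
    rcases hx with rfl | hx
    · exact mem_span_singleton'.mpr ⟨-387 + 134 * thetaInt hα - 21 * thetaInt hα ^ 2, by linear_combination (55 + 21 * thetaInt hα) * hrel⟩
    · rw [Set.mem_singleton_iff.mp hx]
      exact mem_span_singleton'.mpr ⟨-148 + 51 * thetaInt hα - 8 * thetaInt hα ^ 2, by linear_combination (21 + 8 * thetaInt hα) * hrel⟩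
  · rw [span_singleton_le_iff_mem, mem_span_pair]
    exact ⟨-141 - 341 * thetaInt hα + 91 * thetaInt hα ^ 2, -6 - 6 * thetaInt hα - 5 * thetaInt hα ^ 2, by linear_combination (-41 - 5 * thetaInt hα) * hrel⟩

/-- **Every prime of `𝓞_F` above `2` is principal** (Dedekind–Kummer with `polyMod_2` and the generators above).
[cite: Marcus2018, Ch. 3, Thm. 27] [cite: LMFDB, number field 3.1.14539.1 (class number 1)] -/
theorem isPrincipal_of_mem_primesOver_2 (h3 : finrank ℚ F = 3) (hα : aeval α (poly (-6) (16) (7)) = 0) {P : Ideal (𝓞 F)}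
    (hP : P ∈ primesOver (span {((2 : ℕ) : ℤ)}) (𝓞 F)) : Submodule.IsPrincipal P := by
  haveI : Fact (Nat.Prime 2) := ⟨by norm_num⟩
  obtain ⟨Qb, hirr, hmon, hdvd, -, hspan⟩ :=
    exists_factor_of_mem_primesOver irreducible_polyQ hα h3 isUnit_of_disc_eq_sq_mul (by norm_num : Nat.Prime 2) hP
  rw [polyMod_2] at hdvd
  rcases hirr.prime.dvd_or_dvd hdvd with h | h
  · have hirr1 : Irreducible (X + 1 : (ZMod 2)[X]) := by
      rw [show (X + 1 : (ZMod 2)[X]) = X - C (-1) by rw [map_neg, map_one, sub_neg_eq_add]]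
      exact irreducible_X_sub_C _
    have hQb : Qb = X + 1 := eq_of_monic_of_associated hmon (by monicity!) (hirr.associated_of_dvd hirr1 h)
    have hPeq := hspan (X + 1) (by rw [hQb]; simp)
    rw [show aeval (thetaInt hα) (X + 1 : ℤ[X]) = thetaInt hα + 1 by
        simp only [map_add, aeval_X, map_one], Nat.cast_ofNat, span_2_lin1_eq hα] at hPeq
    exact ⟨⟨-387 + 134 * thetaInt hα - 21 * thetaInt hα ^ 2, by rw [hPeq, Ideal.submodule_span_eq]⟩⟩
  · have hQb : Qb = X ^ 2 + X + 1 :=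
      eq_of_monic_of_associated hmon (by monicity!) (hirr.associated_of_dvd CubicDisc307.irreducible_quad_two h)
    have hPeq := hspan (X ^ 2 + X + 1) (by rw [hQb]; simp)
    rw [show aeval (thetaInt hα) (X ^ 2 + X + 1 : ℤ[X]) = thetaInt hα ^ 2 + thetaInt hα + 1 by
        simp only [map_add, map_pow, aeval_X, map_one], Nat.cast_ofNat, span_2_quad_eq hα] at hPeq
    exact ⟨⟨-1 - 3 * thetaInt hα - thetaInt hα ^ 2, by rw [hPeq, Ideal.submodule_span_eq]⟩⟩

/-- `(3, θ + 2) = (-262 - 587 * θ + 270 * θ ^ 2)` (an element of norm `±3`). [cite: Marcus2018, Ch. 3, Thm. 27] -/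
theorem span_3_lin2_eq (hα : aeval α (poly (-6) (16) (7)) = 0) :
    span {(3 : 𝓞 F), thetaInt hα + 2} = span {-262 - 587 * thetaInt hα + 270 * thetaInt hα ^ 2} := by
  have hrel := theta_rel hα
  apply le_antisymm
  · rw [span_le]
    rintro x hx
    rcases hx with rfl | hx
    · exact mem_span_singleton'.mpr ⟨-11621282 + 4024268 * thetaInt hα - 630769 * thetaInt hα ^ 2, by linear_combination (434967983 - 170307630 * thetaInt hα) * hrel⟩
    · rw [Set.mem_singleton_iff.mp hx]
      exact mem_span_singleton'.mpr ⟨-6275727 + 2173186 * thetaInt hα - 340628 * thetaInt hα ^ 2, by linear_combination (234891496 - 91969560 * thetaInt hα) * hrel⟩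
  · rw [span_singleton_le_iff_mem, mem_span_pair]
    exact ⟨-95 - 217 * thetaInt hα + 105 * thetaInt hα ^ 2, -6 - 5 * thetaInt hα - 5 * thetaInt hα ^ 2, by linear_combination (-5) * hrel⟩

/-- `(3, θ² + 1θ + 2) = (25 + 62 * θ - 10 * θ ^ 2)` (an element of norm `9`). [cite: Marcus2018, Ch. 3, Thm. 27] -/
theorem span_3_quad_eq (hα : aeval α (poly (-6) (16) (7)) = 0) :
    span {(3 : 𝓞 F), thetaInt hα ^ 2 + thetaInt hα + 2} = span {25 + 62 * thetaInt hα - 10 * thetaInt hα ^ 2} := by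
  have hrel := theta_rel hα
  apply le_antisymm
  · rw [span_le]
    rintro x hx
    rcases hx with rfl | hx
    · exact mem_span_singleton'.mpr ⟨12123 - 4198 * thetaInt hα + 658 * thetaInt hα ^ 2, by linear_combination (43296 - 6580 * thetaInt hα) * hrel⟩
    · rw [Set.mem_singleton_iff.mp hx]
      exact mem_span_singleton'.mpr ⟨7130 - 2469 * thetaInt hα + 387 * thetaInt hα ^ 2, by linear_combination (25464 - 3870 * thetaInt hα) * hrel⟩
  · rw [span_singleton_le_iff_mem, mem_span_pair]
    exact ⟨-67 - 164 * thetaInt hα + 50 * thetaInt hα ^ 2, -6 - 6 * thetaInt hα - 4 * thetaInt hα ^ 2, by linear_combination (-34 - 4 * thetaInt hα) * hrel⟩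

/-- **Every prime of `𝓞_F` above `3` is principal** (Dedekind–Kummer with `polyMod_3` and the generators above).
[cite: Marcus2018, Ch. 3, Thm. 27] [cite: LMFDB, number field 3.1.14539.1 (class number 1)] -/
theorem isPrincipal_of_mem_primesOver_3 (h3 : finrank ℚ F = 3) (hα : aeval α (poly (-6) (16) (7)) = 0) {P : Ideal (𝓞 F)}
    (hP : P ∈ primesOver (span {((3 : ℕ) : ℤ)}) (𝓞 F)) : Submodule.IsPrincipal P := by
  haveI : Fact (Nat.Prime 3) := ⟨by norm_num⟩
  obtain ⟨Qb, hirr, hmon, hdvd, -, hspan⟩ :=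
    exists_factor_of_mem_primesOver irreducible_polyQ hα h3 isUnit_of_disc_eq_sq_mul (by norm_num : Nat.Prime 3) hP
  rw [polyMod_3] at hdvd
  rcases hirr.prime.dvd_or_dvd hdvd with h | h
  · have hirr1 : Irreducible (X + 2 : (ZMod 3)[X]) := by
      rw [show (X + 2 : (ZMod 3)[X]) = X - C (-2) by rw [map_neg, map_ofNat]; ring]
      exact irreducible_X_sub_C _
    have hQb : Qb = X + 2 := eq_of_monic_of_associated hmon (by monicity!) (hirr.associated_of_dvd hirr1 h)
    have hPeq := hspan (X + C 2) (by rw [hQb]; simp [map_ofNat])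
    rw [show aeval (thetaInt hα) (X + C 2 : ℤ[X]) = thetaInt hα + 2 by
        simp only [map_add, aeval_X, aeval_C, algebraMap_int_eq, Int.coe_castRingHom, Int.cast_ofNat], Nat.cast_ofNat, span_3_lin2_eq hα] at hPeq
    exact ⟨⟨-262 - 587 * thetaInt hα + 270 * thetaInt hα ^ 2, by rw [hPeq, Ideal.submodule_span_eq]⟩⟩
  · have hQb : Qb = X ^ 2 + X + 2 :=
      eq_of_monic_of_associated hmon (by monicity!) (hirr.associated_of_dvd CubicDisc307.irreducible_quad_three h)
    have hPeq := hspan (X ^ 2 + X + C 2) (by rw [hQb]; simp [map_ofNat])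
    rw [show aeval (thetaInt hα) (X ^ 2 + X + C 2 : ℤ[X]) = thetaInt hα ^ 2 + thetaInt hα + 2 by
        simp only [map_add, map_pow, aeval_X, aeval_C, algebraMap_int_eq, Int.coe_castRingHom, Int.cast_ofNat], Nat.cast_ofNat, span_3_quad_eq hα] at hPeq
    exact ⟨⟨25 + 62 * thetaInt hα - 10 * thetaInt hα ^ 2, by rw [hPeq, Ideal.submodule_span_eq]⟩⟩

/-- **Every prime of `𝓞_F` above `5` is principal**: `5` is inert, the prime is `(5)`. [cite: Marcus2018, Ch. 3, Thm. 27] -/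
theorem isPrincipal_of_mem_primesOver_5 (h3 : finrank ℚ F = 3) (hα : aeval α (poly (-6) (16) (7)) = 0) {P : Ideal (𝓞 F)}
    (hP : P ∈ primesOver (span {((5 : ℕ) : ℤ)}) (𝓞 F)) : Submodule.IsPrincipal P := by
  have hPeq := eq_span_of_no_root irreducible_polyQ hα h3 isUnit_of_disc_eq_sq_mul (by norm_num : Nat.Prime 5) hP no_root_5
  exact ⟨⟨((5 : ℕ) : 𝓞 F), by rw [hPeq, Ideal.submodule_span_eq]⟩⟩

/-- `(7, θ + 0) = (-θ)` (an element of norm `±7`). [cite: Marcus2018, Ch. 3, Thm. 27] -/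
theorem span_7_lin0_eq (hα : aeval α (poly (-6) (16) (7)) = 0) :
    span {(7 : 𝓞 F), thetaInt hα} = span {-thetaInt hα} := by
  have hrel := theta_rel hα
  apply le_antisymm
  · rw [span_le]
    rintro x hx
    rcases hx with rfl | hx
    · exact mem_span_singleton'.mpr ⟨16 - 6 * thetaInt hα + thetaInt hα ^ 2, by linear_combination (-1) * hrel⟩
    · rw [Set.mem_singleton_iff.mp hx]
      exact mem_span_singleton'.mpr ⟨-1, by linear_combination ((0 : 𝓞 F)) * hrel⟩
  · rw [span_singleton_le_iff_mem, mem_span_pair]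
    exact ⟨-6 - 13 * thetaInt hα + 6 * thetaInt hα ^ 2, -6 - 6 * thetaInt hα - 6 * thetaInt hα ^ 2, by linear_combination (-6) * hrel⟩

/-- `(7, θ + 4) = (55 + 144 * θ - 2 * θ ^ 2)` (an element of norm `±7`). [cite: Marcus2018, Ch. 3, Thm. 27] -/
theorem span_7_lin4_eq (hα : aeval α (poly (-6) (16) (7)) = 0) :
    span {(7 : 𝓞 F), thetaInt hα + 4} = span {55 + 144 * thetaInt hα - 2 * thetaInt hα ^ 2} := by
  have hrel := theta_rel hα
  apply le_antisymm
  · rw [span_le]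
    rintro x hx
    rcases hx with rfl | hx
    · exact mem_span_singleton'.mpr ⟨353409 - 122380 * thetaInt hα + 19182 * thetaInt hα ^ 2, by linear_combination (2776784 - 38364 * thetaInt hα) * hrel⟩
    · rw [Set.mem_singleton_iff.mp hx]
      exact mem_span_singleton'.mpr ⟨182766 - 63289 * thetaInt hα + 9920 * thetaInt hα ^ 2, by linear_combination (1436018 - 19840 * thetaInt hα) * hrel⟩
  · rw [span_singleton_le_iff_mem, mem_span_pair]
    exact ⟨8 + 22 * thetaInt hα + 2 * thetaInt hα ^ 2, -2 - 6 * thetaInt hα - thetaInt hα ^ 2, by linear_combination (-1) * hrel⟩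

/-- **Every prime of `𝓞_F` above `7` is principal** (Dedekind–Kummer with `polyMod_7` and the generators above).
[cite: Marcus2018, Ch. 3, Thm. 27] [cite: LMFDB, number field 3.1.14539.1 (class number 1)] -/
theorem isPrincipal_of_mem_primesOver_7 (h3 : finrank ℚ F = 3) (hα : aeval α (poly (-6) (16) (7)) = 0) {P : Ideal (𝓞 F)}
    (hP : P ∈ primesOver (span {((7 : ℕ) : ℤ)}) (𝓞 F)) : Submodule.IsPrincipal P := by
  haveI : Fact (Nat.Prime 7) := ⟨by norm_num⟩
  obtain ⟨Qb, hirr, hmon, hdvd, -, hspan⟩ :=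
    exists_factor_of_mem_primesOver irreducible_polyQ hα h3 isUnit_of_disc_eq_sq_mul (by norm_num : Nat.Prime 7) hP
  rw [polyMod_7] at hdvd
  rcases hirr.prime.dvd_or_dvd hdvd with h12 | h
  · rcases hirr.prime.dvd_or_dvd h12 with h | h
    · have hQb : Qb = X := eq_of_monic_of_associated hmon monic_X (hirr.associated_of_dvd irreducible_X h)
      have hPeq := hspan X (by rw [hQb, Polynomial.map_X])
      rw [aeval_X, Nat.cast_ofNat, span_7_lin0_eq hα] at hPeq
      exact ⟨⟨-thetaInt hα, by rw [hPeq, Ideal.submodule_span_eq]⟩⟩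
    · have hirr1 : Irreducible (X + 4 : (ZMod 7)[X]) := by
        rw [show (X + 4 : (ZMod 7)[X]) = X - C (-4) by rw [map_neg, map_ofNat]; ring]
        exact irreducible_X_sub_C _
      have hQb : Qb = X + 4 := eq_of_monic_of_associated hmon (by monicity!) (hirr.associated_of_dvd hirr1 h)
      have hPeq := hspan (X + C 4) (by rw [hQb]; simp [map_ofNat])
      rw [show aeval (thetaInt hα) (X + C 4 : ℤ[X]) = thetaInt hα + 4 by
          simp only [map_add, aeval_X, aeval_C, algebraMap_int_eq, Int.coe_castRingHom, Int.cast_ofNat], Nat.cast_ofNat, span_7_lin4_eq hα] at hPeq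
      exact ⟨⟨55 + 144 * thetaInt hα - 2 * thetaInt hα ^ 2, by rw [hPeq, Ideal.submodule_span_eq]⟩⟩
  · have hirr1 : Irreducible (X + 4 : (ZMod 7)[X]) := by
      rw [show (X + 4 : (ZMod 7)[X]) = X - C (-4) by rw [map_neg, map_ofNat]; ring]
      exact irreducible_X_sub_C _
    have hQb : Qb = X + 4 := eq_of_monic_of_associated hmon (by monicity!) (hirr.associated_of_dvd hirr1 h)
    have hPeq := hspan (X + C 4) (by rw [hQb]; simp [map_ofNat])
    rw [show aeval (thetaInt hα) (X + C 4 : ℤ[X]) = thetaInt hα + 4 by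
        simp only [map_add, aeval_X, aeval_C, algebraMap_int_eq, Int.coe_castRingHom, Int.cast_ofNat], Nat.cast_ofNat, span_7_lin4_eq hα] at hPeq
    exact ⟨⟨55 + 144 * thetaInt hα - 2 * thetaInt hα ^ 2, by rw [hPeq, Ideal.submodule_span_eq]⟩⟩

/-- `f` has no root modulo `11`: `11` is inert. [cite: Marcus2018, Ch. 3, Thm. 27] -/
theorem no_root_11' : ∀ r : ZMod 11, r ^ 3 + ((-6 : ℤ) : ZMod 11) * r ^ 2 + ((16 : ℤ) : ZMod 11) * r + ((7 : ℤ) : ZMod 11) ≠ 0 := by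
  decide

/-- **Every prime of `𝓞_F` above `11` is principal**: `11` is inert, the prime is `(11)`. [cite: Marcus2018, Ch. 3, Thm. 27] -/
theorem isPrincipal_of_mem_primesOver_11 (h3 : finrank ℚ F = 3) (hα : aeval α (poly (-6) (16) (7)) = 0) {P : Ideal (𝓞 F)}
    (hP : P ∈ primesOver (span {((11 : ℕ) : ℤ)}) (𝓞 F)) : Submodule.IsPrincipal P := by
  have hPeq := eq_span_of_no_root irreducible_polyQ hα h3 isUnit_of_disc_eq_sq_mul (by norm_num : Nat.Prime 11) hP no_root_11'
  exact ⟨⟨((11 : ℕ) : 𝓞 F), by rw [hPeq, Ideal.submodule_span_eq]⟩⟩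

end NumberField

end Literature.NumberTheory.CubicFields.CubicDisc14539

end
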